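import Literature.MathematicalPhysics.QuantumFieldTheory.Balaban1983to89.Node00.OpsYSectEStar
import Literature.MathematicalPhysics.QuantumFieldTheory.Balaban1983to89.Node00.OpsYSectEElimSmall

/-!
# `Balaban1983to89.Node00.OpsYSectEElimStar` — T. Bałaban, *Propagators for lattice gauge theories in a background field*, Commun. Math. Phys. **99**
# (1985) 389–434 [Balaban1985BackgroundPropagators], Sect. E (3.157)–(3.158) p. 428 (with [5] = *Averaging operations for lattice gauge theories*, CMP
# **98** (1985) 17–51 [Balaban1985Averaging], (125) p. 36, and [4] = *Propagators … II*, CMP **96** (1984) 223–250 [Balaban1984PropagatorsII], (2.3) p. 224,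
# Lemma 2.4 p. 245, (2.154)–(2.156) pp. 249–250): THE LETTERS `Λ̃`, `C(V)`, `C(V)*` OF (3.157) IN THE STAR CONVENTION — STAR EDITION, PART 3 (the pivot
# coefficients `K_c`, the letters `C ∕ C*` indexed by the STAR corners `c ∈ Λ′` (at least one good end block), their faces, the seven-letter star record
# and the star instance of record `opsYStOfRecordV7E`; the PARTS 2–3 DOOR REQUIREMENT `C_st(1)Φ ∈` print's star subspace)

statement-level construction with citation tags; proofs where landed; nothing here is a claim about the Yang–Mills mass gap, the continuum limit or OS.

THE PRINT (p. 428): *«Let us take the subspace of functions B …: B = 0 on Λᶜ (Dirichlet boundary conditions), B = 0 on ⋃_{y∈Λ′} Δ_k(y) (the axial gauge in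
all big blocks of Λ), Q(V)B = 0 on Λ′.  An arbitrary function B on this subspace can be represented with the help of a function B̃ defined on Λ̃ = Λ ∖
{⋃_{y∈Λ′} Δ_k(y) ∪ ⋃_{c∈Λ′} B(c) ∩ c}.  Here B(c) ∩ c consists of the exactly one bond b₀ of B(c) contained in c.  The values of B at these bonds b₀ can be
determined by the equalities (Q(V)B)(c) = 0, c ∈ Λ′, and we define the linear operator C by B = CB̃ (3.157).»*  [4] (2.3) p. 224 ∕ Lemma 2.4 p. 245: «Λ also
[denotes] the set of bonds b such that at least one of the end-points b₋, b₊ belongs to Λ» — the STAR convention for BOTH «B = 0 on Λᶜ» and «c ∈ Λ′».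

ERRATUM → `Node00.OpsYSectEElim` HONEST MARGIN (i) (dag-n08-b CHECK-L, 2026-08-29; concurred node00-def-Y WORD-L, dag-n08-d).  That file reads «c ∈ Λ′» as
«an `L`-corner with BOTH end blocks good» (`IsCoarseY`) and the variables in the SOURCE convention (`inΛY`, `lamTY`); its margin (i) says «a bond leaving `Λ′`
carries no constraint here».  At every member with a good block facing a non-good block this leaves the `⟨good → non-good⟩` corners UNCONSTRAINED, and the
block-constant pure gauges `g = ∂^{(k)}λ` (`λ` constant on `L`-blocks, `0 ∕ δ ∕ δ ∕ 0` around two slabs of good blocks) lie in that subspace AND in the kernel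
of `Δ_k(1)` (Schur: `⟨g, ((QGQ*)⁻¹ − a)g⟩ = ‖∂Hg‖² = 0`), so NO `γ₀ > 0` row holds on it and `secCornerY (lamTY x) (CsDeltaCY … 1)` is singular there
(memo `pub-ymgap-dag-n08-b/N08-CHECK-L-g36.md`).  Print's subspace is the STAR one: constraints at every corner with AT LEAST ONE good end block, variables on
the bonds with at least one good end block; there every coarse pure gauge in the subspace is `0` and [4] (2.153) holds ([4] Lemma 2.4).  Nothing landed is
false (the old faces are correct implications on a narrower door); THIS FILE types the star letters side by side, over STAR EDITION part 1
(`OpsYSectEStarGeometry`: `inΛstY`, `IsCoarseStY ∕ CBondStY`, `pivIStY`, `IsPivStY`, `lamTstY`) and part 2 (`OpsYSectEStar`: `SectELettersStY`, `secΛstY`,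
the dressed star letters).

WHAT IS BUILT (member `x`, averaged-field parameter `𝔳 : AvY 𝔸 x` as in `OpsYSectEElim`; `Q(V) = Q1Y`, `Q(V)* = Q1TY`, `readUY ∕ placeUY`, the transports
and every geometric lemma are `OpsYSectEElim`'s BY NAME — nothing re-declared):
§1 `pivIStY_injective`, `not_isAxialY_pivIStY`, `not_lamTstY_pivIStY` (star pivots: distinct, not tree bonds, not variables).
§2 ★ `KstY x 𝔳 U c` (`c : CBondStY x`) — THE PIVOT COEFFICIENT `a ↦ (Q(V)(δ_{b₀(c)} ⊗ a))(c)` at a STAR corner (`KstY_toSt`: on the old corners it IS `KY`);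
   ★★★ `elimCstY x 𝔳 : IBondOpY 𝔸 x.toKIdx`, `C(V) = P_{Λ̃} − Σ_{c ∈ Λ′_st} ι_{b₀(c)} K_c(V)⁻¹ (Q(V)·)(c) P_{Λ̃}` — THE LETTER `C` OF (3.157), STAR; `elimCstY_apply`.
§3 FACES: support `elimCstY_apply_eq_zero ∕ _of_isAxialY ∕ _of_not_inΛstY` (Dirichlet in the STAR sense), ★ `elimCstY_apply_of_lamTstY` (identity on `Λ̃`),
   `elimCstY_mul_secY`, `secΛstY_mul_elimCstY`; ★ `Q1Y_single_pivIStY_of_ne ∕ _self` (the pivot system is DIAGONAL over the star corners — `OpsYSectEElim`'s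
   `eq_of_upivU_mem_usegY` needs corners only); `elimCstY_eq`; ★★ `Q1Y_elimCstY (hK)` — THE CONSTRAINTS HOLD ON THE RANGE AT EVERY STAR CORNER; `secY_lamTstY_eq_sub`;
   ★★★ `elimCstY_eq_self_of_constraints`.  AT `U = 1`: ★★ `KstY_one` (`K_c(1) = L^{−(d+1)}·id` at EVERY star corner — `OpsYSectEElim.KY_one`'s count uses the
   corner only), `isUnit_KstY_one`, `Q1Y_elimCstY_one`, `elimCstY_one_eq_self_of_constraints`.
§4 TRANSPOSES: `KTstY` (`K_c*`), `tr_KstY_mul`, `tr_inverse_KstY_mul`; ★★★ `elimCtstY` — THE LETTER `C*`, STAR; `elimCtstY_eq`; ★★★ `sum_tr_elimCstY_mul (hK) (hKT)`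
   (`C*` IS THE TRACE-TRANSPOSE OF `C`); `secY_mul_elimCtstY`, `elimCtstY_mul_secΛstY`; at `U = 1`: `KTstY_one`, `isUnit_KTstY_one`, ★★ `sum_tr_elimCstY_mul_one`
   (hypothesis-free).
§5 THE RECORD: ★★ `sectELettersStYOfRecordTC x 𝔳 𝔢₀ : SectELettersStY 𝔸 x` := part 2's `ofParams` of def-Y's four-letter record `sectELettersYOfRecordT x 𝔳 𝔢₀`
   (`μ ∕ D̄ ∕ μ* ∕ D̄*` genuine) with `Λ̃ := lamTstY x`, `C := elimCstY x 𝔳`, `C* := elimCtstY x 𝔳` — SEVEN letters genuine, `⟨D̃⁽²⁾, J⟩ ∕ G̃₂` stay `𝔢₀`'s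
   (`_letters ∕ _params`); `elimCΛstY_sectELettersStYOfRecordTC ∕ elimCtΛstY_…` (part 2's dressed `P_Λ^st C P_Λ̃ ∕ P_Λ̃ C* P_Λ^st` ARE `C(V) ∕ C(V)*` here),
   `CkStY_…`, `CsDeltaCstY_… ∕ CsDeltaCPstY_…`, `deltaKstY_sectELettersStYOfRecordTC` (= def-Y's `deltaKY … (sectELettersYOfRecordTC …)`, `rfl`).
§6 RECORD LEVEL (`M_N(ℂ)`, `SU(N)`): ★★ `sectEStYOfRecordV7 N θ M⋆ 𝔢₀ x := sectELettersStYOfRecordTC x (avYOfRecord x) (𝔢₀ x)` (input `𝔢₀ : SectEY` unchanged,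
   output `SectEStY`); ★★★ `opsYStOfRecordV7E N θ M⋆ 𝔯 𝔢₀ 𝔴 𝔈 := opsYStOfRecordV4E … 𝔯 (sectEStYOfRecordV7 … 𝔢₀) 𝔴 𝔈` — THE STAR INSTANCE OF RECORD (v6E
   binder shape; `𝔯 := resYOfC2 𝔠`, `𝔢₀ := sectEYWithDt2 …` give the v7∕v8 residual shapes by composition); `_eq`, `_apply`, `_letters`, `_params`,
   `CkStY_sectEStYOfRecordV7`, `sum_trace_elimC_elimCt_sectEStYOfRecordV7 (hK hKT)` and `…_one` (hypothesis-free).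
§7 ★★★ THE PARTS 2–3 DOOR REQUIREMENT (def-Y HANDOFF § g25; dag-n08-d p690485 §5's three binder facts): for every `Φ`, `B := C_st(1)Φ = elimCstY x (avYOfRecord x) 1 Φ`
   satisfies `∀ q, ¬ inΛstY x q → B q = 0`, `∀ q, IsAxialY x q → B q = 0`, `∀ c : CBondStY x, Q1Y x (avYOfRecord x) 1 c.1 B = 0` (`elimCstY_one_mem_starSubspace`),
   and `B = Φ` on `Λ̃` (`elimCstY_one_apply_of_lamTstY`) — so the (2.153) row at NODE 00's letters for `B` is dag-n08-d's one-liner over dag-n08-b's `scalarRow_star`.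

HONEST MARGINS. (i) STAR CORNERS: print's «c ∈ Λ′» = an `L`-corner with AT LEAST ONE end block `B(c₋)`, `B(c₊)` good (`IsCoarseStY`, part 1); the pivot
`b₀(c) = B(c) ∩ c` is `OpsYSectEElim.upivU` unchanged (always a star variable, `inΛstY_pivIStY`).  (ii) INVERTIBILITY of `K_c(V)` is NOT claimed for `U ≠ 1`:
`C`, `C*` use `Ring.inverse`; the range ∕ parametrisation ∕ adjointness faces carry `IsUnit (KstY …)` (and `IsUnit (KTstY …)`) hypotheses, discharged here at
`U = 1` only (`KstY_one ∕ KTstY_one`: `K_c(1) = L^{−(d+1)} id`); for small fields `K_c(V) = L^{−(d+1)}(id + O(|V − 1|))` is print's regime — the star twins of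
`OpsYSectEElimSmall ∕ OpsYSectEElimAxial` (`isUnit_KY_of_smallVY`, …) are NOT typed here (successor, on word).  (iii) TRANSPOSES are for the FLAT trace pairing
`Σ_q τ(B(q)A(q))` with `R(V)* = R(V⁻¹)` for a tracial `τ` (convention (v) of `OpsYSectELetters`).  (iv) `V = 𝔳 U` is the lineage's averaged-field DICTIONARY
(`avYOfRecord` at the record; `= 1` at `U = 1`); `Q(V)` is [5]'s MAIN TERM (125); at a star corner whose source block is not good, `Q1Y` carries no comb
transport inside `B(c₋)` (`uΓ = []` off `Λ′`) — exact at `U = 1`, a declared dictionary elsewhere (as `OpsYSectEElim` margin (iv)).  (v) `⟨D̃⁽²⁾, J⟩` and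
`G̃₂` remain PARAMETERS; nothing of (3.159)–(3.184) is claimed; `LocalOuterY`-type rows for the star record (N06's row 24 at the star instance) are NOT typed
here.  Net new unproved facts: 0.  Filed by seat dag-n08-b (g37) under node00-def-Y's names per the CONDITIONAL HANDOVER of 2026-08-29 (bus I.45144 ∕
I.45186); def-Y's successor reviews ∕ extends by name (the instance name `opsYOfRecordV7E` of def-Y's type map is TAKEN by `OpsYDelta2Form`'s v7 instance at
`resYOfC2 𝔠`, whence `opsYStOfRecordV7E`).
-/

noncomputable section

namespace Literature.MathematicalPhysics.QuantumFieldTheory.Balaban1983to89.Node00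

open B9Eq3169Mu
open B9Eq39Adjoint (R R_inv_R R_R_inv R_one R_smul trace_R_mul)
open B9PinMembersKLevelV1 (MemberY)
open B9PinGeometryKLevelV1 (inΛY)
open B6GlobalChartV1 (PV toBox domT)
open B6BondElimination (unitVec unitVec_apply add_unitVec_apply)
open B9Eq3169Comb (comb mem_comb_iff corner_of_mem_comb)
open B9Thm315WholeSectERep (LocalOuterY)

variable {d ℓ : ℕ} {hd : 1 ≤ d + 1} {hL : Odd (ℓ + 1) ∧ 1 < ℓ + 1} {b₀ b₁ : ℝ} {Mstar : ℕ}

/-! ## §1 Star pivots: injective, not tree bonds, not variables -/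

section StarPivots

variable (x : MemberY d ℓ hd hL b₀ b₁ Mstar)

/-- ★ `c ↦ b₀(c)` is injective on the STAR corners (the pivot determines the coarse bond among corners, `OpsYSectEElim.upivU_inj`).
[cite: Balaban1985BackgroundPropagators, p.428 («exactly one bond b₀»), bookkeeping] -/
theorem pivIStY_injective : Function.Injective (pivIStY x) := fun c c' e =>
  Subtype.ext (upivU_inj x (isCoarseStY_of x c).1 (isCoarseStY_of x c').1 (idxOfU_inj x e))

/-- a star pivot is not a tree bond (its offset along `c` is `L − 1`; `OpsYSectEElim.upivU_ne_of_mem_comb`).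
[cite: Balaban1984PropagatorsII, (2.154) p.249; Balaban1985BackgroundPropagators, p.428] -/
theorem not_isAxialY_pivIStY (c : CBondStY x) : ¬ IsAxialY x (pivIStY x c) := by
  classical
  rintro ⟨y, hy⟩
  unfold uΓ at hy
  split_ifs at hy with hg
  · rw [List.mem_pmap] at hy
    obtain ⟨b, hb, e⟩ := hy
    exact upivU_ne_of_mem_comb x (isCoarseStY_of x c).1 hb (idxOfU_inj x e)
  · simp at hy

/-- a star pivot is not in `Λ̃`. [cite: Balaban1985BackgroundPropagators, p.428, bookkeeping] -/
theorem not_lamTstY_pivIStY (c : CBondStY x) : ¬ lamTstY x (pivIStY x c) := fun h => h.2.2 ⟨c, rfl⟩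

end StarPivots

/-! ## §2 The pivot coefficient `K_c` at a star corner and THE LETTER `C` of (3.157), STAR CONVENTION -/

section Elim

variable {𝔸 : Type} [NormedRing 𝔸] [NormedAlgebra ℂ 𝔸] [CompleteSpace 𝔸]
variable (x : MemberY d ℓ hd hL b₀ b₁ Mstar) (𝔳 : AvY 𝔸 x)

open Classical in
/-- ★ **THE PIVOT COEFFICIENT `K_c(V)` AT A STAR CORNER** `c ∈ Λ′` (at least one good end block): `a ↦ (Q(V)(δ_{b₀(c)} ⊗ a))(c)`.
[cite: Balaban1985BackgroundPropagators, p.428 («considered as an equation on the variable B(b₀)»); Balaban1984PropagatorsII, Lemma 2.4 p.245 (star Λ)] -/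
def KstY (U : CfgY 𝔸 x.toKIdx) (c : CBondStY x) : Module.End ℂ 𝔸 :=
  Q1Y x 𝔳 U c.1 ∘ₗ LinearMap.single ℂ (fun _ : IBondY x.toKIdx => 𝔸) (pivIStY x c)

open Classical in
/-- `K_c` evaluated. [cite: Balaban1985BackgroundPropagators, p.428, bookkeeping] -/
theorem KstY_apply (U : CfgY 𝔸 x.toKIdx) (c : CBondStY x) (a : 𝔸) : KstY x 𝔳 U c a = Q1Y x 𝔳 U c.1 (Pi.single (pivIStY x c) a) := rfl

/-- on the old (both-good) corners the star pivot coefficient IS `OpsYSectEElim.KY`. [cite: Balaban1985BackgroundPropagators, p.428, bookkeeping] -/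
theorem KstY_toSt (U : CfgY 𝔸 x.toKIdx) (c : CBondY x) : KstY x 𝔳 U (CBondY.toSt x c) = KY x 𝔳 U c := rfl

open Classical in
/-- ★★★ **THE LETTER `C` OF (3.157)–(3.158), STAR CONVENTION** — the parametrisation `B = C B̃` of print's constrained axial subspace (variables on the
bonds with at least one end block in `Λ′`, constraints at EVERY star corner) by the variables `Λ̃` (part 1's `lamTstY`):
`C(V) = P_{Λ̃} − Σ_{c ∈ Λ′_st} ι_{b₀(c)} K_c(V)⁻¹ (Q(V) · )(c) P_{Λ̃}` (`Ring.inverse` for `K_c⁻¹`).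
[cite: Balaban1985BackgroundPropagators, (3.157)–(3.158) p.428; Balaban1984PropagatorsII, (2.154)–(2.156) pp.249–250, (2.3) p.224] -/
def elimCstY : IBondOpY 𝔸 x.toKIdx := fun U =>
  secY 𝔸 (lamTstY x) - ∑ c : CBondStY x,
    LinearMap.single ℂ (fun _ : IBondY x.toKIdx => 𝔸) (pivIStY x c) ∘ₗ Ring.inverse (KstY x 𝔳 U c) ∘ₗ Q1Y x 𝔳 U c.1 ∘ₗ secY 𝔸 (lamTstY x)

open Classical in
/-- **`C` EVALUATED**: `(C B)(q) = (P_{Λ̃}B)(q) − [q = b₀(c)] K_c⁻¹ (Q(V) P_{Λ̃}B)(c)`. [cite: Balaban1985BackgroundPropagators, (3.157) p.428] -/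
theorem elimCstY_apply (U : CfgY 𝔸 x.toKIdx) (B : IBondY x.toKIdx → 𝔸) (q : IBondY x.toKIdx) :
    elimCstY x 𝔳 U B q = secY 𝔸 (lamTstY x) B q -
      ∑ c : CBondStY x, if q = pivIStY x c then Ring.inverse (KstY x 𝔳 U c) (Q1Y x 𝔳 U c.1 (secY 𝔸 (lamTstY x) B)) else 0 := by
  simp only [elimCstY, LinearMap.sub_apply, LinearMap.coe_sum, Finset.sum_apply, LinearMap.comp_apply, LinearMap.single_apply,
    Pi.sub_apply]
  congr 1
  refine Finset.sum_congr rfl fun c _ => ?_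
  by_cases h : q = pivIStY x c
  · subst h; rw [if_pos rfl, Pi.single_eq_same]
  · rw [if_neg h, Pi.single_eq_of_ne h]

end Elim

/-! ## §3 Faces of the star `C`: support, constraints on the range, identity on `Λ̃`, parametrisation; the pivot coefficient at `U = 1` -/

section Faces

variable {𝔸 : Type} [NormedRing 𝔸] [NormedAlgebra ℂ 𝔸] [CompleteSpace 𝔸]
variable (x : MemberY d ℓ hd hL b₀ b₁ Mstar) (𝔳 : AvY 𝔸 x)

/-- **SUPPORT OF `C`**: `(C B)(q) = 0` at a bond that is neither a variable (`Λ̃`) nor a star pivot. [cite: Balaban1985BackgroundPropagators, (3.157) p.428, bookkeeping] -/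
theorem elimCstY_apply_eq_zero (U : CfgY 𝔸 x.toKIdx) (B : IBondY x.toKIdx → 𝔸) {q : IBondY x.toKIdx} (h1 : ¬ lamTstY x q) (h2 : ¬ IsPivStY x q) :
    elimCstY x 𝔳 U B q = 0 := by
  classical
  rw [elimCstY_apply, secY_apply_of_not h1, Finset.sum_eq_zero, sub_zero]
  intro c _
  rw [if_neg]
  rintro rfl
  exact h2 ⟨c, rfl⟩

/-- ★ **THE AXIAL GAUGE ON THE RANGE**: `C B = 0` on the tree bonds `⋃_{y ∈ Λ′} Δ_k(y)`. [cite: Balaban1985BackgroundPropagators, (3.157) p.428 («B = 0 on ⋃_{y∈Λ′} Δ_k(y)»)] -/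
theorem elimCstY_apply_of_isAxialY (U : CfgY 𝔸 x.toKIdx) (B : IBondY x.toKIdx → 𝔸) {q : IBondY x.toKIdx} (hq : IsAxialY x q) :
    elimCstY x 𝔳 U B q = 0 :=
  elimCstY_apply_eq_zero x 𝔳 U B (fun h => h.2.1 hq) (by rintro ⟨c, rfl⟩; exact not_isAxialY_pivIStY x c hq)

/-- ★ **DIRICHLET CONDITIONS ON THE RANGE, STAR SENSE**: `C B = 0` off the bonds with at least one end block in `Λ′` (print's «B = 0 on Λᶜ» with [4] (2.3)).
[cite: Balaban1985BackgroundPropagators, (3.157) p.428 («B = 0 on Λᶜ»); Balaban1984PropagatorsII, (2.3) p.224] -/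
theorem elimCstY_apply_of_not_inΛstY (U : CfgY 𝔸 x.toKIdx) (B : IBondY x.toKIdx → 𝔸) {q : IBondY x.toKIdx} (hq : ¬ inΛstY x q) :
    elimCstY x 𝔳 U B q = 0 :=
  elimCstY_apply_eq_zero x 𝔳 U B (fun h => hq h.1) (by rintro ⟨c, rfl⟩; exact hq (inΛstY_pivIStY x c))

/-- ★ **`C` IS THE IDENTITY ON `Λ̃`**. [cite: Balaban1985BackgroundPropagators, (3.157) p.428 («an identity operator on almost all bonds, except the bonds b₀»)] -/
theorem elimCstY_apply_of_lamTstY (U : CfgY 𝔸 x.toKIdx) (B : IBondY x.toKIdx → 𝔸) {q : IBondY x.toKIdx} (hq : lamTstY x q) :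
    elimCstY x 𝔳 U B q = B q := by
  classical
  rw [elimCstY_apply, secY_apply_of hq, Finset.sum_eq_zero, sub_zero]
  intro c _
  rw [if_neg]
  rintro rfl
  exact hq.2.2 ⟨c, rfl⟩

/-- **`C` READS ITS ARGUMENT ON `Λ̃` ONLY**: `C P_{Λ̃} = C`. [cite: Balaban1985BackgroundPropagators, (3.157) p.428, bookkeeping] -/
theorem elimCstY_mul_secY (U : CfgY 𝔸 x.toKIdx) : elimCstY x 𝔳 U * secY 𝔸 (lamTstY x) = elimCstY x 𝔳 U := by
  apply LinearMap.ext
  intro B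
  have hP : secY 𝔸 (lamTstY x) (secY 𝔸 (lamTstY x) B) = secY 𝔸 (lamTstY x) B := by rw [← Module.End.mul_apply, secY_idem]
  rw [Module.End.mul_apply]
  funext q
  rw [elimCstY_apply, elimCstY_apply, hP]

/-- **THE RANGE OF `C` CONSISTS OF FUNCTIONS ON THE STAR BONDS OF `Λ`**: `P_Λ^st C = C`. [cite: Balaban1985BackgroundPropagators, (3.157) p.428; Balaban1984PropagatorsII, (2.3) p.224] -/
theorem secΛstY_mul_elimCstY (U : CfgY 𝔸 x.toKIdx) : secΛstY 𝔸 x * elimCstY x 𝔳 U = elimCstY x 𝔳 U := by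
  apply LinearMap.ext
  intro B
  rw [Module.End.mul_apply]
  funext q
  show secY 𝔸 (inΛstY x) (elimCstY x 𝔳 U B) q = _
  by_cases hq : inΛstY x q
  · rw [secY_apply_of hq]
  · rw [secY_apply_of_not hq, elimCstY_apply_of_not_inΛstY x 𝔳 U B hq]

/-- ★ **`Q(V)` AT A STAR CORNER `c` DOES NOT READ THE PIVOTS OF THE OTHER STAR CORNERS** (the system (3.157) in the pivot unknowns is DIAGONAL over the star
`Λ′`; `OpsYSectEElim.eq_of_upivU_mem_usegY` needs the corners only). [cite: Balaban1985BackgroundPropagators, p.428; Balaban1984PropagatorsII, (2.154)–(2.155) p.249] -/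
theorem Q1Y_single_pivIStY_of_ne (U : CfgY 𝔸 x.toKIdx) {c c' : CBondStY x} (h : c' ≠ c) (a : 𝔸) :
    Q1Y x 𝔳 U c.1 (Pi.single (pivIStY x c') a) = 0 := by
  classical
  rw [Q1Y_apply, Finset.sum_eq_zero, smul_zero]
  intro z hz
  rw [trSum_eq_zero, map_zero]
  intro b hb
  unfold pivIStY
  rw [readUY_single, if_neg]
  rintro rfl
  exact h (Subtype.ext (eq_of_upivU_mem_usegY x (isCoarseStY_of x c').1 (isCoarseStY_of x c).1 hz hb))

/-- the diagonal entry of the system is `K_c`. [cite: Balaban1985BackgroundPropagators, p.428, bookkeeping] -/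
theorem Q1Y_single_pivIStY_self (U : CfgY 𝔸 x.toKIdx) (c : CBondStY x) (a : 𝔸) :
    Q1Y x 𝔳 U c.1 (Pi.single (pivIStY x c) a) = KstY x 𝔳 U c a := rfl

open Classical in
/-- `C` as a difference of functions. [cite: Balaban1985BackgroundPropagators, (3.157) p.428, bookkeeping] -/
theorem elimCstY_eq (U : CfgY 𝔸 x.toKIdx) (B : IBondY x.toKIdx → 𝔸) : elimCstY x 𝔳 U B =
    secY 𝔸 (lamTstY x) B - ∑ c : CBondStY x, Pi.single (pivIStY x c) (Ring.inverse (KstY x 𝔳 U c) (Q1Y x 𝔳 U c.1 (secY 𝔸 (lamTstY x) B))) := by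
  simp only [elimCstY, LinearMap.sub_apply, LinearMap.coe_sum, Finset.sum_apply, LinearMap.comp_apply, LinearMap.single_apply]

/-- ★★ **THE CONSTRAINTS (3.157) HOLD ON THE RANGE OF `C` AT EVERY STAR CORNER**: `(Q(V) C(V)B)(c) = 0` at every `c ∈ Λ′` (at least one good end block)
whose pivot coefficient `K_c(V)` is a unit. [cite: Balaban1985BackgroundPropagators, (3.157) p.428; Balaban1984PropagatorsII, Lemma 2.4 p.245] -/
theorem Q1Y_elimCstY (U : CfgY 𝔸 x.toKIdx) {c : CBondStY x} (hK : IsUnit (KstY x 𝔳 U c)) (B : IBondY x.toKIdx → 𝔸) :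
    Q1Y x 𝔳 U c.1 (elimCstY x 𝔳 U B) = 0 := by
  classical
  have hw : ∀ c' : CBondStY x, Q1Y x 𝔳 U c.1 (Pi.single (pivIStY x c') (Ring.inverse (KstY x 𝔳 U c') (Q1Y x 𝔳 U c'.1 (secY 𝔸 (lamTstY x) B)))) =
      if c' = c then Q1Y x 𝔳 U c.1 (secY 𝔸 (lamTstY x) B) else 0 := by
    intro c'
    by_cases h : c' = c
    · subst h
      rw [if_pos rfl, Q1Y_single_pivIStY_self, ← Module.End.mul_apply, Ring.mul_inverse_cancel _ hK, Module.End.one_apply]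
    · rw [if_neg h]
      exact Q1Y_single_pivIStY_of_ne x 𝔳 U h _
  rw [elimCstY_eq, map_sub, map_sum, Finset.sum_congr rfl fun c' _ => hw c', Finset.sum_ite_eq', if_pos (Finset.mem_univ _), sub_self]

open Classical in
omit [CompleteSpace 𝔸] in
/-- the restriction to `Λ̃` of a function supported on `Λ̃ ∪ {star pivots}` loses exactly the pivot values. [cite: Balaban1985BackgroundPropagators, p.428, bookkeeping] -/
theorem secY_lamTstY_eq_sub (B : IBondY x.toKIdx → 𝔸) (hsupp : ∀ q, ¬ lamTstY x q → ¬ IsPivStY x q → B q = 0) :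
    secY 𝔸 (lamTstY x) B = B - ∑ c : CBondStY x, Pi.single (pivIStY x c) (B (pivIStY x c)) := by
  funext q
  simp only [Pi.sub_apply, Finset.sum_apply, Pi.single_apply]
  by_cases h1 : lamTstY x q
  · rw [secY_apply_of h1, Finset.sum_eq_zero, sub_zero]
    intro c _
    rw [if_neg]
    rintro rfl
    exact h1.2.2 ⟨c, rfl⟩
  · rw [secY_apply_of_not h1]
    by_cases h2 : IsPivStY x q
    · obtain ⟨c₀, rfl⟩ := h2
      rw [Finset.sum_eq_single c₀, if_pos rfl, sub_self]
      · intro c _ hc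
        rw [if_neg]
        exact fun e => hc (pivIStY_injective x e.symm)
      · intro h
        exact absurd (Finset.mem_univ _) h
    · rw [Finset.sum_eq_zero, sub_zero, hsupp q h1 h2]
      intro c _
      rw [if_neg]
      rintro rfl
      exact h2 ⟨c, rfl⟩

open Classical in
/-- ★★★ **`C` INVERTS THE RESTRICTION TO `Λ̃` ON PRINT's CONSTRAINED SUBSPACE** («B = CB̃» IS A PARAMETRISATION, star): a bond function supported on
`Λ̃ ∪ {b₀(c)}` (Dirichlet off the star bonds, axial gauge) with `(Q(V)B)(c) = 0` at every star corner is reproduced from its restriction: `C(V)(P_{Λ̃}B) =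
C(V)B = B` (all `K_c(V)` units). [cite: Balaban1985BackgroundPropagators, (3.157) p.428 («an arbitrary function B on this subspace can be represented»); Balaban1984PropagatorsII, (2.154)–(2.156) pp.249–250] -/
theorem elimCstY_eq_self_of_constraints (U : CfgY 𝔸 x.toKIdx) (B : IBondY x.toKIdx → 𝔸) (hK : ∀ c : CBondStY x, IsUnit (KstY x 𝔳 U c))
    (hsupp : ∀ q, ¬ lamTstY x q → ¬ IsPivStY x q → B q = 0) (hQ : ∀ c : CBondStY x, Q1Y x 𝔳 U c.1 B = 0) : elimCstY x 𝔳 U B = B := by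
  have hdec := secY_lamTstY_eq_sub x B hsupp
  have hpiv : ∀ c : CBondStY x, Ring.inverse (KstY x 𝔳 U c) (Q1Y x 𝔳 U c.1 (secY 𝔸 (lamTstY x) B)) = - B (pivIStY x c) := by
    intro c
    have hq : Q1Y x 𝔳 U c.1 (secY 𝔸 (lamTstY x) B) = - KstY x 𝔳 U c (B (pivIStY x c)) := by
      rw [hdec, map_sub, hQ c, map_sum, zero_sub, Finset.sum_eq_single c]
      · rfl
      · intro c' _ hc'
        exact Q1Y_single_pivIStY_of_ne x 𝔳 U hc' _
      · intro h
        exact absurd (Finset.mem_univ _) h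
    rw [hq, map_neg, ← Module.End.mul_apply, Ring.inverse_mul_cancel _ (hK c), Module.End.one_apply]
  rw [elimCstY_eq]
  simp only [hpiv, Pi.single_neg, Finset.sum_neg_distrib, sub_neg_eq_add]
  rw [hdec, sub_add_cancel]

/-! ### the star pivot coefficient at `U = 1`: `K_c(1) = L^{−(d+1)}·id` at EVERY star corner -/

/-- ★★ **THE PIVOT COEFFICIENT AT `U = 1` IS THE SCALAR `L^{−(d+1)}` AT EVERY STAR CORNER**: at the record's averaged field (`V(1) = 1`, identity transports)
exactly `L` of the `L·L^{d+1}` (segment, bond) pairs of `(Q(1)·)(c)` read the pivot `b₀(c)` — the count uses the CORNER only (`OpsYSectEElim.KY_one`'s proof,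
verbatim), so it holds whether one or both end blocks are good.  In particular `K_c(1)` is a unit at every star corner.
[cite: Balaban1985Averaging, (125) p.36; Balaban1985BackgroundPropagators, p.428; Balaban1984PropagatorsII, (2.154) p.249, Lemma 2.4 p.245] -/
theorem KstY_one (c : CBondStY x) (a : 𝔸) :
    KstY x (avYOfRecord x) (fun _ _ => 1 : CfgY 𝔸 x.toKIdx) c a = ((((ℓ + 1 : ℕ) : ℂ)) ^ (d + 1))⁻¹ • a := by
  classical
  obtain ⟨⟨y, μ⟩, hc⟩ := c
  have hy : IsCornerY x y := ((mem_coarseStY x).1 hc).1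
  have hT : ∀ (b : UBondY x) (v : 𝔸), RUY x (avYOfRecord x) (fun _ _ => 1 : CfgY 𝔸 x.toKIdx) b v = v := fun b v => by
    rw [RUY_apply, avYOfRecord_one, R_one]
  rw [KstY_apply, Q1Y_apply]
  unfold pivIStY
  simp only [hol_apply_of_id _ (RVY_avYOfRecord_one x), trSum_usegY_of_id x _ hT, readUY_single]
  rw [Finset.sum_comm]
  have hs : ∀ s ∈ Finset.range (ℓ + 1),
      (∑ z ∈ ublockY x y, if (⟨ofZ x (labK x z + (s : ℤ) • unitVec μ), μ⟩ : UBondY x) = upivU x (y, μ) then a else 0) = a := by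
    intro s hs
    rw [Finset.mem_range] at hs
    have hiff : ∀ z : USiteY x, (⟨ofZ x (labK x z + (s : ℤ) • unitVec μ), μ⟩ : UBondY x) = upivU x (y, μ) ↔
        z = ofZ x (labK x y + ((ℓ : ℤ) - s) • unitVec μ) := by
      intro z
      rw [← ofZ_add_eq_upivU_src_iff x hy z μ hs]
      constructor
      · intro e; exact congrArg PBond.src e
      · intro e; exact congrArg (fun w => (⟨w, μ⟩ : UBondY x)) e
    simp_rw [hiff]
    rw [Finset.sum_ite_eq', if_pos (ofZ_add_mem_ublockY x hy μ (by omega) (by omega))]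
  rw [Finset.sum_congr rfl hs, Finset.sum_const, Finset.card_range, ← Nat.cast_smul_eq_nsmul ℂ, smul_smul, qNormY, pow_succ, mul_inv,
    inv_mul_cancel_right₀ (Nat.cast_ne_zero.2 (Nat.succ_ne_zero ℓ))]

/-- ★ at `U = 1` every star pivot coefficient is a unit. [cite: Balaban1985BackgroundPropagators, p.428, bookkeeping] -/
theorem isUnit_KstY_one (c : CBondStY x) : IsUnit (KstY x (avYOfRecord x) (fun _ _ => 1 : CfgY 𝔸 x.toKIdx) c) := by
  have hL : ((((ℓ + 1 : ℕ) : ℂ)) ^ (d + 1))⁻¹ ≠ 0 := inv_ne_zero (pow_ne_zero _ (Nat.cast_ne_zero.2 (Nat.succ_ne_zero ℓ)))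
  have e : KstY x (avYOfRecord x) (fun _ _ => 1 : CfgY 𝔸 x.toKIdx) c = ((((ℓ + 1 : ℕ) : ℂ)) ^ (d + 1))⁻¹ • (1 : Module.End ℂ 𝔸) := by
    apply LinearMap.ext
    intro a
    rw [KstY_one, LinearMap.smul_apply, Module.End.one_apply]
  rw [e, ← Algebra.algebraMap_eq_smul_one]
  exact (isUnit_iff_ne_zero.2 hL).map (algebraMap ℂ (Module.End ℂ 𝔸))

/-- ★ **AT `U = 1` THE CONSTRAINTS HOLD ON THE RANGE OF `C(1)` AT EVERY STAR CORNER, UNCONDITIONALLY**. [cite: Balaban1985BackgroundPropagators, (3.157) p.428; Balaban1984PropagatorsII, (2.154)–(2.156) pp.249–250, Lemma 2.4 p.245] -/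
theorem Q1Y_elimCstY_one (c : CBondStY x) (B : IBondY x.toKIdx → 𝔸) :
    Q1Y x (avYOfRecord x) (fun _ _ => 1 : CfgY 𝔸 x.toKIdx) c.1 (elimCstY x (avYOfRecord x) (fun _ _ => 1) B) = 0 :=
  Q1Y_elimCstY x (avYOfRecord x) _ (isUnit_KstY_one x c) B

/-- ★ **AT `U = 1`, `C(1)` REPRODUCES EVERY FUNCTION OF PRINT's CONSTRAINED AXIAL STAR SUBSPACE** ([4]'s flat parametrisation (2.154)–(2.156) on NODE 00's
carrier, star). [cite: Balaban1984PropagatorsII, (2.154)–(2.156) pp.249–250; Balaban1985BackgroundPropagators, (3.157) p.428] -/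
theorem elimCstY_one_eq_self_of_constraints (B : IBondY x.toKIdx → 𝔸) (hsupp : ∀ q, ¬ lamTstY x q → ¬ IsPivStY x q → B q = 0)
    (hQ : ∀ c : CBondStY x, Q1Y x (avYOfRecord x) (fun _ _ => 1 : CfgY 𝔸 x.toKIdx) c.1 B = 0) :
    elimCstY x (avYOfRecord x) (fun _ _ => 1) B = B :=
  elimCstY_eq_self_of_constraints x (avYOfRecord x) _ B (isUnit_KstY_one x) hsupp hQ

end Faces

/-! ## §4 The star transpose `C*` for the trace pairing `Σ_q τ(B(q)A(q))` -/

section Transpose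

variable {𝔸 : Type} [NormedRing 𝔸] [NormedAlgebra ℂ 𝔸] [CompleteSpace 𝔸]
variable (x : MemberY d ℓ hd hL b₀ b₁ Mstar) (𝔳 : AvY 𝔸 x)

open Classical in
/-- **THE TRANSPOSE `K_c(V)*` OF THE STAR PIVOT COEFFICIENT**: `v ↦ (Q(V)* v)(b₀(c))`. [cite: Balaban1985BackgroundPropagators, p.428, (3.9) p.391, bookkeeping] -/
def KTstY (U : CfgY 𝔸 x.toKIdx) (c : CBondStY x) : Module.End ℂ 𝔸 := LinearMap.proj (pivIStY x c) ∘ₗ Q1TY x 𝔳 U c.1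

/-- `K_c*` evaluated. [cite: Balaban1985BackgroundPropagators, p.428, bookkeeping] -/
theorem KTstY_apply (U : CfgY 𝔸 x.toKIdx) (c : CBondStY x) (v : 𝔸) : KTstY x 𝔳 U c v = Q1TY x 𝔳 U c.1 v (pivIStY x c) := rfl

/-- on the old corners `K_c*` (star) IS `OpsYSectEElim.KTY`. [cite: Balaban1985BackgroundPropagators, p.428, bookkeeping] -/
theorem KTstY_toSt (U : CfgY 𝔸 x.toKIdx) (c : CBondY x) : KTstY x 𝔳 U (CBondY.toSt x c) = KTY x 𝔳 U c := rfl

/-- ★ **`K_c*` IS THE TRANSPOSE OF `K_c`**: `τ(K_c a · v) = τ(a · K_c* v)`. [cite: Balaban1985BackgroundPropagators, (3.9) p.391, p.428] -/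
theorem tr_KstY_mul (τ : 𝔸 →ₗ[ℂ] ℂ) (hτ : ∀ a b : 𝔸, τ (a * b) = τ (b * a)) (U : CfgY 𝔸 x.toKIdx) (c : CBondStY x) (a v : 𝔸) :
    τ (KstY x 𝔳 U c a * v) = τ (a * KTstY x 𝔳 U c v) := by
  classical
  rw [KstY_apply, tr_Q1Y_mul x 𝔳 τ hτ, Finset.sum_eq_single (pivIStY x c)]
  · rw [Pi.single_eq_same, KTstY_apply]
  · intro q _ hq
    rw [Pi.single_eq_of_ne hq, zero_mul, map_zero]
  · intro h
    exact absurd (Finset.mem_univ _) h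

/-- ★ **THE TRANSPOSE OF `K_c⁻¹` IS `(K_c*)⁻¹`** (both units). [cite: Balaban1985BackgroundPropagators, (3.9) p.391, p.428, bookkeeping] -/
theorem tr_inverse_KstY_mul (τ : 𝔸 →ₗ[ℂ] ℂ) (hτ : ∀ a b : 𝔸, τ (a * b) = τ (b * a)) (U : CfgY 𝔸 x.toKIdx) (c : CBondStY x)
    (hK : IsUnit (KstY x 𝔳 U c)) (hKT : IsUnit (KTstY x 𝔳 U c)) (a v : 𝔸) :
    τ (Ring.inverse (KstY x 𝔳 U c) a * v) = τ (a * Ring.inverse (KTstY x 𝔳 U c) v) := by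
  have ha : KstY x 𝔳 U c (Ring.inverse (KstY x 𝔳 U c) a) = a := by
    rw [← Module.End.mul_apply, Ring.mul_inverse_cancel _ hK, Module.End.one_apply]
  have hv : KTstY x 𝔳 U c (Ring.inverse (KTstY x 𝔳 U c) v) = v := by
    rw [← Module.End.mul_apply, Ring.mul_inverse_cancel _ hKT, Module.End.one_apply]
  calc τ (Ring.inverse (KstY x 𝔳 U c) a * v) = τ (Ring.inverse (KstY x 𝔳 U c) a * KTstY x 𝔳 U c (Ring.inverse (KTstY x 𝔳 U c) v)) := by rw [hv]
    _ = τ (KstY x 𝔳 U c (Ring.inverse (KstY x 𝔳 U c) a) * Ring.inverse (KTstY x 𝔳 U c) v) := (tr_KstY_mul x 𝔳 τ hτ U c _ _).symm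
    _ = τ (a * Ring.inverse (KTstY x 𝔳 U c) v) := by rw [ha]

open Classical in
/-- ★★★ **THE LETTER `C*` OF (3.157), STAR CONVENTION** — the transpose of `C(V)` for the trace pairing:
`C(V)* = P_{Λ̃} − Σ_{c ∈ Λ′_st} P_{Λ̃} Q(V)*_c (K_c(V)*)⁻¹ ev_{b₀(c)}`. [cite: Balaban1985BackgroundPropagators, (3.157) p.428 («C*g»), (3.9) p.391; Balaban1984PropagatorsII, (2.3) p.224] -/
def elimCtstY : IBondOpY 𝔸 x.toKIdx := fun U =>
  secY 𝔸 (lamTstY x) - ∑ c : CBondStY x,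
    secY 𝔸 (lamTstY x) ∘ₗ Q1TY x 𝔳 U c.1 ∘ₗ Ring.inverse (KTstY x 𝔳 U c) ∘ₗ LinearMap.proj (pivIStY x c)

open Classical in
/-- `C*` as a difference of functions. [cite: Balaban1985BackgroundPropagators, (3.157) p.428, bookkeeping] -/
theorem elimCtstY_eq (U : CfgY 𝔸 x.toKIdx) (A : IBondY x.toKIdx → 𝔸) : elimCtstY x 𝔳 U A =
    secY 𝔸 (lamTstY x) A - ∑ c : CBondStY x, secY 𝔸 (lamTstY x) (Q1TY x 𝔳 U c.1 (Ring.inverse (KTstY x 𝔳 U c) (A (pivIStY x c)))) := by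
  simp only [elimCtstY, LinearMap.sub_apply, LinearMap.coe_sum, Finset.sum_apply, LinearMap.comp_apply, LinearMap.proj_apply]

/-- ★★★ **`C*` IS THE TRANSPOSE OF `C` (star)**: `Σ_q τ((C(V)B)(q)·A(q)) = Σ_q τ(B(q)·(C(V)*A)(q))` for every tracial `τ`, whenever the star pivot coefficients
`K_c(V)` and their transposes are units. [cite: Balaban1985BackgroundPropagators, (3.157) p.428, (3.9) p.391 + p.390] -/
theorem sum_tr_elimCstY_mul (τ : 𝔸 →ₗ[ℂ] ℂ) (hτ : ∀ a b : 𝔸, τ (a * b) = τ (b * a)) (U : CfgY 𝔸 x.toKIdx)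
    (hK : ∀ c : CBondStY x, IsUnit (KstY x 𝔳 U c)) (hKT : ∀ c : CBondStY x, IsUnit (KTstY x 𝔳 U c)) (B A : IBondY x.toKIdx → 𝔸) :
    ∑ q, τ (elimCstY x 𝔳 U B q * A q) = ∑ q, τ (B q * elimCtstY x 𝔳 U A q) := by
  classical
  have hc : ∀ c : CBondStY x,
      ∑ q, τ ((Pi.single (pivIStY x c) (Ring.inverse (KstY x 𝔳 U c) (Q1Y x 𝔳 U c.1 (secY 𝔸 (lamTstY x) B))) : IBondY x.toKIdx → 𝔸) q * A q) =
        ∑ q, τ (B q * secY 𝔸 (lamTstY x) (Q1TY x 𝔳 U c.1 (Ring.inverse (KTstY x 𝔳 U c) (A (pivIStY x c)))) q) := by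
    intro c
    rw [Finset.sum_eq_single (pivIStY x c) (fun q _ hq => by rw [Pi.single_eq_of_ne hq, zero_mul, map_zero])
      (fun h => absurd (Finset.mem_univ _) h), Pi.single_eq_same, tr_inverse_KstY_mul x 𝔳 τ hτ U c (hK c) (hKT c),
      tr_Q1Y_mul x 𝔳 τ hτ, sum_tr_secY_mul]
  simp only [elimCstY_eq, elimCtstY_eq, Pi.sub_apply, Finset.sum_apply, sub_mul, mul_sub, map_sub, Finset.sum_mul, Finset.mul_sum, map_sum,
    Finset.sum_sub_distrib]
  rw [sum_tr_secY_mul, Finset.sum_comm, Finset.sum_congr rfl fun c _ => hc c, Finset.sum_comm]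

/-- **THE RANGE OF `C*` CONSISTS OF FUNCTIONS ON `Λ̃`**: `P_{Λ̃} C* = C*`. [cite: Balaban1985BackgroundPropagators, (3.157) p.428 («C*g» a function on Λ̃), bookkeeping] -/
theorem secY_mul_elimCtstY (U : CfgY 𝔸 x.toKIdx) : secY 𝔸 (lamTstY x) * elimCtstY x 𝔳 U = elimCtstY x 𝔳 U := by
  apply LinearMap.ext
  intro A
  have hP : ∀ f : IBondY x.toKIdx → 𝔸, secY 𝔸 (lamTstY x) (secY 𝔸 (lamTstY x) f) = secY 𝔸 (lamTstY x) f := fun f => by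
    rw [← Module.End.mul_apply, secY_idem]
  rw [Module.End.mul_apply, elimCtstY_eq, map_sub, map_sum]
  simp only [hP]

/-- **`C*` READS ITS ARGUMENT ON THE STAR BONDS OF `Λ` ONLY**: `C* P_Λ^st = C*`. [cite: Balaban1985BackgroundPropagators, (3.157) p.428; Balaban1984PropagatorsII, (2.3) p.224, bookkeeping] -/
theorem elimCtstY_mul_secΛstY (U : CfgY 𝔸 x.toKIdx) : elimCtstY x 𝔳 U * secΛstY 𝔸 x = elimCtstY x 𝔳 U := by
  apply LinearMap.ext
  intro A
  have hP : secY 𝔸 (lamTstY x) (secΛstY 𝔸 x A) = secY 𝔸 (lamTstY x) A := by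
    rw [← Module.End.mul_apply]
    exact congrFun (congrArg DFunLike.coe (secY_mul_secY_of_imp' (𝔸 := 𝔸) (fun _ h => lamTstY_inΛst x h))) A
  have hpiv : ∀ c : CBondStY x, secΛstY 𝔸 x A (pivIStY x c) = A (pivIStY x c) := fun c => secY_apply_of (inΛstY_pivIStY x c) A
  rw [Module.End.mul_apply, elimCtstY_eq, elimCtstY_eq, hP]
  simp only [hpiv]

/-! ### the transposes at `U = 1` -/

/-- ★★ **THE TRANSPOSE STAR PIVOT COEFFICIENT AT `U = 1` IS THE SCALAR `L^{−(d+1)}`** (`OpsYSectEElimSmall.KTY_one`'s count, corners only).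
[cite: Balaban1985BackgroundPropagators, (3.9) p.391, (3.157) p.428; Balaban1985Averaging, (125) p.36] -/
theorem KTstY_one (c : CBondStY x) (v : 𝔸) :
    KTstY x (avYOfRecord x) (fun _ _ => 1 : CfgY 𝔸 x.toKIdx) c v = ((((ℓ + 1 : ℕ) : ℂ)) ^ (d + 1))⁻¹ • v := by
  classical
  obtain ⟨⟨y, μ⟩, hc⟩ := c
  have hy : IsCornerY x y := ((mem_coarseStY x).1 hc).1
  have hS : ∀ (b : UBondY x) (w : 𝔸), RUTY x (avYOfRecord x) (fun _ _ => 1 : CfgY 𝔸 x.toKIdx) b w = w := fun b w => by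
    rw [RUTY_apply, avYOfRecord_one, inv_one, R_one]
  have hsymm : ∀ z : USiteY x, (hol (RVY x (avYOfRecord x) (fun _ _ => 1 : CfgY 𝔸 x.toKIdx)) (uΓ x z)).symm v = v := fun z => by
    rw [LinearEquiv.symm_apply_eq, hol_apply_of_id _ (RVY_avYOfRecord_one x)]
  have hz : ∀ z : USiteY x, (((usegY x z μ).map fun b => if upivU x (y, μ) = b then v else 0)).sum =
      ∑ s ∈ Finset.range (ℓ + 1), if (⟨ofZ x (labK x z + ((s : ℕ) : ℤ) • unitVec μ), μ⟩ : UBondY x) = upivU x (y, μ) then v else 0 := by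
    intro z
    rw [usegY, List.map_map, list_sum_range_map]
    refine Finset.sum_congr rfl fun s _ => ?_
    simp only [Function.comp_apply, @eq_comm _ (upivU x (y, μ))]
  rw [KTstY_apply, Q1TY_apply, Pi.smul_apply]
  unfold q1TFunY pivIStY
  rw [Finset.sum_apply]
  simp only [hsymm, placeUY_idxOfU, trSumT_apply_of_id _ hS, hz]
  rw [Finset.sum_comm]
  have hs : ∀ s ∈ Finset.range (ℓ + 1),
      (∑ z ∈ ublockY x y, if (⟨ofZ x (labK x z + (s : ℤ) • unitVec μ), μ⟩ : UBondY x) = upivU x (y, μ) then v else 0) = v := by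
    intro s hs
    rw [Finset.mem_range] at hs
    have hiff : ∀ z : USiteY x, (⟨ofZ x (labK x z + (s : ℤ) • unitVec μ), μ⟩ : UBondY x) = upivU x (y, μ) ↔
        z = ofZ x (labK x y + ((ℓ : ℤ) - s) • unitVec μ) := by
      intro z
      rw [← ofZ_add_eq_upivU_src_iff x hy z μ hs]
      constructor
      · intro e; exact congrArg PBond.src e
      · intro e; exact congrArg (fun w => (⟨w, μ⟩ : UBondY x)) e
    simp_rw [hiff]
    rw [Finset.sum_ite_eq', if_pos (ofZ_add_mem_ublockY x hy μ (by omega) (by omega))]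
  rw [Finset.sum_congr rfl hs, Finset.sum_const, Finset.card_range, ← Nat.cast_smul_eq_nsmul ℂ, smul_smul, qNormY, pow_succ, mul_inv,
    inv_mul_cancel_right₀ (Nat.cast_ne_zero.2 (Nat.succ_ne_zero ℓ))]

/-- ★ at `U = 1` every transpose star pivot coefficient is a unit. [cite: Balaban1985BackgroundPropagators, (3.157) p.428, bookkeeping] -/
theorem isUnit_KTstY_one (c : CBondStY x) : IsUnit (KTstY x (avYOfRecord x) (fun _ _ => 1 : CfgY 𝔸 x.toKIdx) c) := by
  have hL : ((((ℓ + 1 : ℕ) : ℂ)) ^ (d + 1))⁻¹ ≠ 0 := inv_ne_zero (pow_ne_zero _ (Nat.cast_ne_zero.2 (Nat.succ_ne_zero ℓ)))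
  have e : KTstY x (avYOfRecord x) (fun _ _ => 1 : CfgY 𝔸 x.toKIdx) c = ((((ℓ + 1 : ℕ) : ℂ)) ^ (d + 1))⁻¹ • (1 : Module.End ℂ 𝔸) := by
    apply LinearMap.ext
    intro v
    rw [KTstY_one, LinearMap.smul_apply, Module.End.one_apply]
  rw [e, ← Algebra.algebraMap_eq_smul_one]
  exact (isUnit_iff_ne_zero.2 hL).map (algebraMap ℂ (Module.End ℂ 𝔸))

/-- ★★ **THE (3.157) TRACE PAIRING `Σ τ(C B · A) = Σ τ(B · C* A)` AT `U = 1`, STAR, HYPOTHESIS-FREE**. [cite: Balaban1985BackgroundPropagators, (3.157) p.428 («C*»), (3.9) p.391] -/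
theorem sum_tr_elimCstY_mul_one (τ : 𝔸 →ₗ[ℂ] ℂ) (hτ : ∀ a b : 𝔸, τ (a * b) = τ (b * a)) (B A : IBondY x.toKIdx → 𝔸) :
    ∑ q, τ (elimCstY x (avYOfRecord x) (fun _ _ => 1 : CfgY 𝔸 x.toKIdx) B q * A q) =
      ∑ q, τ (B q * elimCtstY x (avYOfRecord x) (fun _ _ => 1 : CfgY 𝔸 x.toKIdx) A q) :=
  sum_tr_elimCstY_mul x (avYOfRecord x) τ hτ _ (isUnit_KstY_one x) (isUnit_KTstY_one x) B A

end Transpose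

/-! ## §5 The star Sect. E letter record with `Λ̃ ∕ C ∕ C*` (star) and `μ ∕ D̄ ∕ μ* ∕ D̄*` (def-Y's record) filled -/

section LettersTC

variable {𝔸 : Type} [NormedRing 𝔸] [NormedAlgebra ℂ 𝔸] [CompleteSpace 𝔸]
variable (x : MemberY d ℓ hd hL b₀ b₁ Mstar) (𝔳 : AvY 𝔸 x)

/-- ★★ **THE SEVEN-LETTER STAR SECT. E RECORD**: def-Y's four-letter record `sectELettersYOfRecordT x 𝔳 𝔢₀` (`μ ∕ D̄ ∕ μ* ∕ D̄*` genuine, `OpsYRecordV5`) with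
its sector-free fields copied (part 2's `ofParams`) AND the star triple `Λ̃ := lamTstY x`, `C := elimCstY x 𝔳`, `C* := elimCtstY x 𝔳`; `⟨D̃⁽²⁾, J⟩` and `G̃₂`
stay `𝔢₀`'s. [cite: Balaban1985BackgroundPropagators, (3.157) p.428, (3.168)–(3.169) p.430, (3.185) p.432; Balaban1984PropagatorsII, (2.3) p.224] -/
def sectELettersStYOfRecordTC (𝔢₀ : SectELettersY 𝔸 x) : SectELettersStY 𝔸 x :=
  SectELettersStY.ofParams (sectELettersYOfRecordT x 𝔳 𝔢₀) (lamTstY x) (fun _ h => lamTstY_inΛst x h) (elimCstY x 𝔳) (elimCtstY x 𝔳)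

/-- the seven-letter star record's letters. [cite: Balaban1985BackgroundPropagators, (3.157) p.428, (3.168)–(3.169) p.430, bookkeeping] -/
theorem sectELettersStYOfRecordTC_letters (𝔢₀ : SectELettersY 𝔸 x) :
    (sectELettersStYOfRecordTC x 𝔳 𝔢₀).LamT = lamTstY x ∧ (sectELettersStYOfRecordTC x 𝔳 𝔢₀).elimC = elimCstY x 𝔳 ∧
      (sectELettersStYOfRecordTC x 𝔳 𝔢₀).elimCt = elimCtstY x 𝔳 ∧ (sectELettersStYOfRecordTC x 𝔳 𝔢₀).mu = muY x 𝔳 ∧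
      (sectELettersStYOfRecordTC x 𝔳 𝔢₀).Dbar = DbarY x 𝔳 ∧ (sectELettersStYOfRecordTC x 𝔳 𝔢₀).muT = muTY x 𝔳 ∧
      (sectELettersStYOfRecordTC x 𝔳 𝔢₀).DbarT = DbarTY x 𝔳 :=
  ⟨rfl, rfl, rfl, rfl, rfl, rfl, rfl⟩

/-- the seven-letter star record keeps `𝔢₀`'s `⟨D̃⁽²⁾, J⟩` and `G̃₂`. [cite: Balaban1985BackgroundPropagators, (3.156) p.428, (3.186) p.432, bookkeeping] -/
theorem sectELettersStYOfRecordTC_params (𝔢₀ : SectELettersY 𝔸 x) :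
    (sectELettersStYOfRecordTC x 𝔳 𝔢₀).D2J = 𝔢₀.D2J ∧ (sectELettersStYOfRecordTC x 𝔳 𝔢₀).Gt2 = 𝔢₀.Gt2 := ⟨rfl, rfl⟩

/-- the star record and def-Y's source-convention seven-letter record `sectELettersYOfRecordTC x 𝔳 𝔢₀` share every sector-free letter
(`D2J ∕ mu ∕ muT ∕ Dbar ∕ DbarT ∕ Gt2`). [cite: Balaban1985BackgroundPropagators, (3.156) p.428, (3.168)–(3.169) p.430, bookkeeping] -/
theorem sectELettersStYOfRecordTC_params_eq_TC (𝔢₀ : SectELettersY 𝔸 x) :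
    (sectELettersStYOfRecordTC x 𝔳 𝔢₀).D2J = (sectELettersYOfRecordTC x 𝔳 𝔢₀).D2J ∧ (sectELettersStYOfRecordTC x 𝔳 𝔢₀).mu = (sectELettersYOfRecordTC x 𝔳 𝔢₀).mu ∧
      (sectELettersStYOfRecordTC x 𝔳 𝔢₀).muT = (sectELettersYOfRecordTC x 𝔳 𝔢₀).muT ∧ (sectELettersStYOfRecordTC x 𝔳 𝔢₀).Dbar = (sectELettersYOfRecordTC x 𝔳 𝔢₀).Dbar ∧
      (sectELettersStYOfRecordTC x 𝔳 𝔢₀).DbarT = (sectELettersYOfRecordTC x 𝔳 𝔢₀).DbarT ∧ (sectELettersStYOfRecordTC x 𝔳 𝔢₀).Gt2 = (sectELettersYOfRecordTC x 𝔳 𝔢₀).Gt2 :=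
  ⟨rfl, rfl, rfl, rfl, rfl, rfl⟩

/-- ★ **part 2's `P_Λ^st C P_{Λ̃}` AT THE STAR RECORD IS `C(V)` ITSELF** (its range lies in the star `Λ`-functions, it reads `Λ̃` only). [cite: Balaban1985BackgroundPropagators, (3.157) p.428, bookkeeping] -/
theorem elimCΛstY_sectELettersStYOfRecordTC (𝔢₀ : SectELettersY 𝔸 x) (U : CfgY 𝔸 x.toKIdx) :
    elimCΛstY x (sectELettersStYOfRecordTC x 𝔳 𝔢₀) U = elimCstY x 𝔳 U := by
  show secΛstY 𝔸 x * elimCstY x 𝔳 U * secY 𝔸 (lamTstY x) = _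
  rw [secΛstY_mul_elimCstY, elimCstY_mul_secY]

/-- ★ **part 2's `P_{Λ̃} C* P_Λ^st` AT THE STAR RECORD IS `C(V)*` ITSELF**. [cite: Balaban1985BackgroundPropagators, (3.157) p.428, bookkeeping] -/
theorem elimCtΛstY_sectELettersStYOfRecordTC (𝔢₀ : SectELettersY 𝔸 x) (U : CfgY 𝔸 x.toKIdx) :
    elimCtΛstY x (sectELettersStYOfRecordTC x 𝔳 𝔢₀) U = elimCtstY x 𝔳 U := by
  show secY 𝔸 (lamTstY x) * elimCtstY x 𝔳 U * secΛstY 𝔸 x = _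
  rw [secY_mul_elimCtstY, elimCtstY_mul_secΛstY]

/-- **(3.158) AT THE STAR RECORD, UNFOLDED**: `C^{(k)}(Λ; U) = C(V) · C̃^{(k)}(Λ; U) · C(V)*` with this file's star `C`, `C*`. [cite: Balaban1985BackgroundPropagators, (3.158) p.428] -/
theorem CkStY_sectELettersStYOfRecordTC (𝔏 : CovLettersY 𝔸 x) (𝔢₀ : SectELettersY 𝔸 x) (U : CfgY 𝔸 x.toKIdx) :
    CkStY x 𝔏 (sectELettersStYOfRecordTC x 𝔳 𝔢₀) U =
      elimCstY x 𝔳 U * CtildeKstY x 𝔏 (sectELettersStYOfRecordTC x 𝔳 𝔢₀) U * elimCtstY x 𝔳 U := by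
  rw [CkStY_apply, elimCΛstY_sectELettersStYOfRecordTC, elimCtΛstY_sectELettersStYOfRecordTC]

/-- **(3.157) AT THE STAR RECORD, UNFOLDED**: `C*Δ_kC = C(V)* · Δ_k(U) · C(V)`. [cite: Balaban1985BackgroundPropagators, (3.157) p.428] -/
theorem CsDeltaCstY_sectELettersStYOfRecordTC (𝔏 : CovLettersY 𝔸 x) (𝔢₀ : SectELettersY 𝔸 x) (U : CfgY 𝔸 x.toKIdx) :
    CsDeltaCstY x 𝔏 (sectELettersStYOfRecordTC x 𝔳 𝔢₀) U =
      elimCtstY x 𝔳 U * deltaKstY x 𝔏 (sectELettersStYOfRecordTC x 𝔳 𝔢₀) U * elimCstY x 𝔳 U := by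
  rw [CsDeltaCstY_apply, elimCΛstY_sectELettersStYOfRecordTC, elimCtΛstY_sectELettersStYOfRecordTC]

/-- **(3.157) in print units at the star record**: `η^{d+1}C*Δ_kC = C(V)* · (η^{d+1}Δ_k(U)) · C(V)`. [cite: Balaban1985BackgroundPropagators, (3.157) p.428, (3.13) p.392] -/
theorem CsDeltaCPstY_sectELettersStYOfRecordTC (𝔏 : CovLettersY 𝔸 x) (𝔢₀ : SectELettersY 𝔸 x) (U : CfgY 𝔸 x.toKIdx) :
    CsDeltaCPstY x 𝔏 (sectELettersStYOfRecordTC x 𝔳 𝔢₀) U =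
      elimCtstY x 𝔳 U * deltaKPstY x 𝔏 (sectELettersStYOfRecordTC x 𝔳 𝔢₀) U * elimCstY x 𝔳 U := by
  rw [CsDeltaCPstY_eq, elimCΛstY_sectELettersStYOfRecordTC, elimCtΛstY_sectELettersStYOfRecordTC]

/-- ★ **`Δ_k` AT THE STAR RECORD IS def-Y's `Δ_k` AT THE SOURCE-CONVENTION RECORD** (`rfl`: both read `𝔢₀.D2J`), so every row stated for
`deltaKY x 𝔏 (sectELettersYOfRecordTC x 𝔳 𝔢₀)` ∕ `deltaKPY …` transfers verbatim. [cite: Balaban1985BackgroundPropagators, (3.156) p.428, bookkeeping] -/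
theorem deltaKstY_sectELettersStYOfRecordTC (𝔏 : CovLettersY 𝔸 x) (𝔢₀ : SectELettersY 𝔸 x) (U : CfgY 𝔸 x.toKIdx) :
    deltaKstY x 𝔏 (sectELettersStYOfRecordTC x 𝔳 𝔢₀) U = deltaKY x 𝔏 (sectELettersYOfRecordTC x 𝔳 𝔢₀) U ∧
      deltaKPstY x 𝔏 (sectELettersStYOfRecordTC x 𝔳 𝔢₀) U = deltaKPY x 𝔏 (sectELettersYOfRecordTC x 𝔳 𝔢₀) U := ⟨rfl, rfl⟩

end LettersTC

/-! ## §6 Record level: the star Sect. E letters of record `sectEStYOfRecordV7` and THE STAR INSTANCE OF RECORD `opsYStOfRecordV7E` -/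

section RecordV7

open scoped Matrix.Norms.L2Operator
open B7Prop2Explicit (unitaryUnits)
open B7Prop2SpecialUnitary (specialUnitaryUnits specialUnitaryUnits_le_unitaryUnits)
open B9PinMembersKLevelV1 (geo9Y bg9Y)
open B9PinGeometryKLevelV1 (c35Y unitDistY)

variable (N : ℕ) (θ : Stage3Params) (Mstar : ℕ)

/-- ★★ **THE STAR SECT. E LETTERS OF A STAGE 3′(Y) FAMILY (v7)**: member by member, `𝔢₀ : SectEY` (source-convention parameters, UNCHANGED input type) with
the SEVEN letters `Λ̃ ∕ C ∕ C* ∕ μ ∕ D̄ ∕ μ* ∕ D̄*` replaced by the genuine ones over the averaged fields of record, `Λ̃ ∕ C ∕ C*` in the STAR convention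
(`⟨D̃⁽²⁾, J⟩ ∕ G̃₂` stay parameters). [cite: Balaban1985BackgroundPropagators, (3.157) p.428, (3.168)–(3.169) p.430, (3.185) p.432; Balaban1984PropagatorsII, (2.3) p.224] -/
def sectEStYOfRecordV7 (𝔢₀ : SectEY N θ Mstar) : SectEStY N θ Mstar := fun x => sectELettersStYOfRecordTC x (avYOfRecord x) (𝔢₀ x)

/-- ★★★ **THE STAR INSTANCE OF RECORD (v7E)** of Stage 3′(Y): part 2's v4-shaped star instance `opsYStOfRecordV4E` AT THE v7 STAR SECT. E LETTERS (same
binder shape as def-Y's `opsYOfRecordV6E 𝔯 𝔢₀ 𝔴 𝔈`; `𝔯 := resYOfC2 𝔠` and `𝔢₀ := sectEYWithDt2 … 𝔡₂ 𝔢₀` give the v7∕v8 residual parametrisations by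
composition). [cite: Balaban1985BackgroundPropagators, Thms 3.1–3.15 pp.397–432, (3.157) p.428; Balaban1984PropagatorsII, (2.3) p.224] -/
def opsYStOfRecordV7E (𝔯 : ResY N θ Mstar) (𝔢₀ : SectEY N θ Mstar) (𝔴 : RWEY N θ Mstar) (𝔈 : ExpsY N θ Mstar) : OpsY N θ Mstar :=
  opsYStOfRecordV4E N θ Mstar 𝔯 (sectEStYOfRecordV7 N θ Mstar 𝔢₀) 𝔴 𝔈

variable (𝔯 : ResY N θ Mstar) (𝔢₀ : SectEY N θ Mstar) (𝔴 : RWEY N θ Mstar) (𝔈 : ExpsY N θ Mstar)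

/-- the star instance is the v4-shaped star instance at the v7 star letters. [cite: Balaban1985BackgroundPropagators, (3.157) p.428, bookkeeping] -/
theorem opsYStOfRecordV7E_eq : opsYStOfRecordV7E N θ Mstar 𝔯 𝔢₀ 𝔴 𝔈 = opsYStOfRecordV4E N θ Mstar 𝔯 (sectEStYOfRecordV7 N θ Mstar 𝔢₀) 𝔴 𝔈 := rfl

/-- the v7 star letters at a member. [cite: Balaban1985BackgroundPropagators, (3.157) p.428, bookkeeping] -/
theorem sectEStYOfRecordV7_apply (x : MemberY θ.d₆ θ.ℓ₆ θ.hd' θ.hL' θ.b₀ θ.b₁ Mstar) :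
    sectEStYOfRecordV7 N θ Mstar 𝔢₀ x = sectELettersStYOfRecordTC x (avYOfRecord x) (𝔢₀ x) := rfl

/-- the v7 star record's seven genuine letters at a member. [cite: Balaban1985BackgroundPropagators, (3.157) p.428, (3.168)–(3.169) p.430, bookkeeping] -/
theorem sectEStYOfRecordV7_letters (x : MemberY θ.d₆ θ.ℓ₆ θ.hd' θ.hL' θ.b₀ θ.b₁ Mstar) :
    (sectEStYOfRecordV7 N θ Mstar 𝔢₀ x).LamT = lamTstY x ∧ (sectEStYOfRecordV7 N θ Mstar 𝔢₀ x).elimC = elimCstY x (avYOfRecord x) ∧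
      (sectEStYOfRecordV7 N θ Mstar 𝔢₀ x).elimCt = elimCtstY x (avYOfRecord x) ∧ (sectEStYOfRecordV7 N θ Mstar 𝔢₀ x).mu = muY x (avYOfRecord x) ∧
      (sectEStYOfRecordV7 N θ Mstar 𝔢₀ x).Dbar = DbarY x (avYOfRecord x) ∧ (sectEStYOfRecordV7 N θ Mstar 𝔢₀ x).muT = muTY x (avYOfRecord x) ∧
      (sectEStYOfRecordV7 N θ Mstar 𝔢₀ x).DbarT = DbarTY x (avYOfRecord x) :=
  ⟨rfl, rfl, rfl, rfl, rfl, rfl, rfl⟩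

/-- the v7 star record keeps `𝔢₀`'s `⟨D̃⁽²⁾, J⟩` and `G̃₂`, and has the same sector-free letters as def-Y's v6 record `sectEYOfRecordV6 N θ M⋆ 𝔢₀`.
[cite: Balaban1985BackgroundPropagators, (3.156) p.428, (3.186) p.432, bookkeeping] -/
theorem sectEStYOfRecordV7_params (x : MemberY θ.d₆ θ.ℓ₆ θ.hd' θ.hL' θ.b₀ θ.b₁ Mstar) :
    (sectEStYOfRecordV7 N θ Mstar 𝔢₀ x).D2J = (𝔢₀ x).D2J ∧ (sectEStYOfRecordV7 N θ Mstar 𝔢₀ x).Gt2 = (𝔢₀ x).Gt2 ∧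
      (sectEStYOfRecordV7 N θ Mstar 𝔢₀ x).D2J = (sectEYOfRecordV6 N θ Mstar 𝔢₀ x).D2J ∧ (sectEStYOfRecordV7 N θ Mstar 𝔢₀ x).mu = (sectEYOfRecordV6 N θ Mstar 𝔢₀ x).mu ∧
      (sectEStYOfRecordV7 N θ Mstar 𝔢₀ x).muT = (sectEYOfRecordV6 N θ Mstar 𝔢₀ x).muT ∧ (sectEStYOfRecordV7 N θ Mstar 𝔢₀ x).Dbar = (sectEYOfRecordV6 N θ Mstar 𝔢₀ x).Dbar ∧
      (sectEStYOfRecordV7 N θ Mstar 𝔢₀ x).DbarT = (sectEYOfRecordV6 N θ Mstar 𝔢₀ x).DbarT ∧ (sectEStYOfRecordV7 N θ Mstar 𝔢₀ x).Gt2 = (sectEYOfRecordV6 N θ Mstar 𝔢₀ x).Gt2 :=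
  ⟨rfl, rfl, rfl, rfl, rfl, rfl, rfl, rfl⟩

/-- ★ `Δ_k` ∕ `η^{d+1}Δ_k` at the v7 star letters ARE def-Y's at the v6 letters (`rfl`) — every Δ_k-row stated at `sectEYOfRecordV6` transfers verbatim.
[cite: Balaban1985BackgroundPropagators, (3.156) p.428, bookkeeping] -/
theorem deltaKstY_sectEStYOfRecordV7 (x : MemberY θ.d₆ θ.ℓ₆ θ.hd' θ.hL' θ.b₀ θ.b₁ Mstar) (𝔏 : CovLettersY (Matrix (Fin N) (Fin N) ℂ) x)
    (U : CfgY (Matrix (Fin N) (Fin N) ℂ) x.toKIdx) :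
    deltaKstY x 𝔏 (sectEStYOfRecordV7 N θ Mstar 𝔢₀ x) U = deltaKY x 𝔏 (sectEYOfRecordV6 N θ Mstar 𝔢₀ x) U ∧
      deltaKPstY x 𝔏 (sectEStYOfRecordV7 N θ Mstar 𝔢₀ x) U = deltaKPY x 𝔏 (sectEYOfRecordV6 N θ Mstar 𝔢₀ x) U := ⟨rfl, rfl⟩

/-- the star instance's base letters, `P349` and expansion slot are def-Y's v4 ∕ v6 instance's (same `𝔯`, `𝔴`, `𝔈`). [cite: Balaban1985BackgroundPropagators, Thms 3.1–3.14 pp.397–427, bookkeeping] -/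
theorem opsYStOfRecordV7E_letters (x : MemberY θ.d₆ θ.ℓ₆ θ.hd' θ.hL' θ.b₀ θ.b₁ Mstar) :
    (opsYStOfRecordV7E N θ Mstar 𝔯 𝔢₀ 𝔴 𝔈 x).P349 = (opsYOfRecordV6E N θ Mstar 𝔯 𝔢₀ 𝔴 𝔈 x).P349 ∧
      (opsYStOfRecordV7E N θ Mstar 𝔯 𝔢₀ 𝔴 𝔈 x).HasRWExpC = (opsYOfRecordV6E N θ Mstar 𝔯 𝔢₀ 𝔴 𝔈 x).HasRWExpC ∧
      (opsYStOfRecordV7E N θ Mstar 𝔯 𝔢₀ 𝔴 𝔈 x).QGQinv = (opsYOfRecordV6E N θ Mstar 𝔯 𝔢₀ 𝔴 𝔈 x).QGQinv ∧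
      (opsYStOfRecordV7E N θ Mstar 𝔯 𝔢₀ 𝔴 𝔈 x).QG1Qinv = (opsYOfRecordV6E N θ Mstar 𝔯 𝔢₀ 𝔴 𝔈 x).QG1Qinv ∧
      (opsYStOfRecordV7E N θ Mstar 𝔯 𝔢₀ 𝔴 𝔈 x).H₁ = (opsYOfRecordV6E N θ Mstar 𝔯 𝔢₀ 𝔴 𝔈 x).H₁ ∧
      (opsYStOfRecordV7E N θ Mstar 𝔯 𝔢₀ 𝔴 𝔈 x).Kdiff = (opsYOfRecordV6E N θ Mstar 𝔯 𝔢₀ 𝔴 𝔈 x).Kdiff :=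
  ⟨rfl, rfl, rfl, rfl, rfl, rfl⟩

/-- ★ ROW 24's kernel at the star instance of record: the index-bond reading of the STAR `C^{(k)}(Λ; ·)` over the v4 letters of record and the v7 star letters.
[cite: Balaban1985BackgroundPropagators, Thm 3.15 (3.187) p.432, bookkeeping] -/
theorem opsYStOfRecordV7E_Ck (x : MemberY θ.d₆ θ.ℓ₆ θ.hd' θ.hL' θ.b₀ θ.b₁ Mstar) :
    (opsYStOfRecordV7E N θ Mstar 𝔯 𝔢₀ 𝔴 𝔈 x).Ck =
      siteKernelOfOp x.toKIdx (bg9Y (Matrix (Fin N) (Fin N) ℂ) (specialUnitaryUnits (Fin N)) x) (fun U => U)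
        (CkStY x (lettersYOfRecordV4 N θ Mstar 𝔯 x) (sectEStYOfRecordV7 N θ Mstar 𝔢₀ x)) id id := rfl

/-- ★ ROW 24's (3.185) slot at the star instance of record. [cite: Balaban1985BackgroundPropagators, Thm 3.15 (3.185) p.432, bookkeeping] -/
theorem opsYStOfRecordV7E_GivenBy3185 (x : MemberY θ.d₆ θ.ℓ₆ θ.hd' θ.hL' θ.b₀ θ.b₁ Mstar) :
    (opsYStOfRecordV7E N θ Mstar 𝔯 𝔢₀ 𝔴 𝔈 x).GivenBy3185 = givenBy3185stY x (lettersYOfRecordV4 N θ Mstar 𝔯 x) (sectEStYOfRecordV7 N θ Mstar 𝔢₀ x) := rfl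

/-- ★ **`C^{(k)}(Λ; U)` OF THE STAR INSTANCE, UNFOLDED TO THIS FILE's `C`, `C*`**: `C(V) · C̃^{(k)}(Λ; U) · C(V)*` at `V = avYOfRecord x U`.
[cite: Balaban1985BackgroundPropagators, (3.158) p.428] -/
theorem CkStY_sectEStYOfRecordV7 (x : MemberY θ.d₆ θ.ℓ₆ θ.hd' θ.hL' θ.b₀ θ.b₁ Mstar) (𝔏 : CovLettersY (Matrix (Fin N) (Fin N) ℂ) x)
    (U : CfgY (Matrix (Fin N) (Fin N) ℂ) x.toKIdx) :
    CkStY x 𝔏 (sectEStYOfRecordV7 N θ Mstar 𝔢₀ x) U =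
      elimCstY x (avYOfRecord x) U * CtildeKstY x 𝔏 (sectEStYOfRecordV7 N θ Mstar 𝔢₀ x) U * elimCtstY x (avYOfRecord x) U :=
  CkStY_sectELettersStYOfRecordTC x (avYOfRecord x) 𝔏 (𝔢₀ x) U

/-- ★ **`η^{d+1}C*Δ_kC` OF THE STAR RECORD, UNFOLDED** (the print-unit precision of the (3.24) doors at the star letters).
[cite: Balaban1985BackgroundPropagators, (3.157) p.428, (3.13) p.392] -/
theorem CsDeltaCPstY_sectEStYOfRecordV7 (x : MemberY θ.d₆ θ.ℓ₆ θ.hd' θ.hL' θ.b₀ θ.b₁ Mstar) (𝔏 : CovLettersY (Matrix (Fin N) (Fin N) ℂ) x)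
    (U : CfgY (Matrix (Fin N) (Fin N) ℂ) x.toKIdx) :
    CsDeltaCPstY x 𝔏 (sectEStYOfRecordV7 N θ Mstar 𝔢₀ x) U =
      elimCtstY x (avYOfRecord x) U * deltaKPY x 𝔏 (sectEYOfRecordV6 N θ Mstar 𝔢₀ x) U * elimCstY x (avYOfRecord x) U :=
  CsDeltaCPstY_sectELettersStYOfRecordTC x (avYOfRecord x) 𝔏 (𝔢₀ x) U

/-- ★ **the v7 star record's `C ∕ C*` are trace-transposes of each other** (all star pivot coefficients and their transposes units).
[cite: Balaban1985BackgroundPropagators, (3.157) p.428, (3.9) p.391] -/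
theorem sum_trace_elimC_elimCt_sectEStYOfRecordV7 (x : MemberY θ.d₆ θ.ℓ₆ θ.hd' θ.hL' θ.b₀ θ.b₁ Mstar) (U : CfgY (Matrix (Fin N) (Fin N) ℂ) x.toKIdx)
    (hK : ∀ c : CBondStY x, IsUnit (KstY x (avYOfRecord x) U c)) (hKT : ∀ c : CBondStY x, IsUnit (KTstY x (avYOfRecord x) U c))
    (B A : IBondY x.toKIdx → Matrix (Fin N) (Fin N) ℂ) :
    ∑ q, Matrix.trace ((sectEStYOfRecordV7 N θ Mstar 𝔢₀ x).elimC U B q * A q) =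
      ∑ q, Matrix.trace (B q * (sectEStYOfRecordV7 N θ Mstar 𝔢₀ x).elimCt U A q) :=
  sum_tr_elimCstY_mul x (avYOfRecord x) (Matrix.traceLinearMap (Fin N) ℂ ℂ) (fun a b => Matrix.trace_mul_comm a b) U hK hKT B A

/-- ★★ **… AT `U = 1`, HYPOTHESIS-FREE**. [cite: Balaban1985BackgroundPropagators, (3.157) p.428, (3.9) p.391] -/
theorem sum_trace_elimC_elimCt_sectEStYOfRecordV7_one (x : MemberY θ.d₆ θ.ℓ₆ θ.hd' θ.hL' θ.b₀ θ.b₁ Mstar)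
    (B A : IBondY x.toKIdx → Matrix (Fin N) (Fin N) ℂ) :
    ∑ q, Matrix.trace ((sectEStYOfRecordV7 N θ Mstar 𝔢₀ x).elimC (fun _ _ => 1) B q * A q) =
      ∑ q, Matrix.trace (B q * (sectEStYOfRecordV7 N θ Mstar 𝔢₀ x).elimCt (fun _ _ => 1) A q) :=
  sum_tr_elimCstY_mul_one x (Matrix.traceLinearMap (Fin N) ℂ ℂ) (fun a b => Matrix.trace_mul_comm a b) B A

end RecordV7

/-! ## §7 THE PARTS 2–3 DOOR REQUIREMENT: `C_st(1)Φ` lies in print's star subspace (node00-def-Y HANDOFF § g25; dag-n08-d p690485 §5) -/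

section DoorRequirement

open scoped Matrix.Norms.L2Operator

variable {𝔸 : Type} [NormedRing 𝔸] [NormedAlgebra ℂ 𝔸] [CompleteSpace 𝔸]
variable (x : MemberY d ℓ hd hL b₀ b₁ Mstar)

/-- ★★★ **THE RANGE OF `C_st(1)` IS PRINT's STAR SUBSPACE OF (3.156)** — for EVERY `Φ`, `B := C_st(1)Φ = elimCstY x (avYOfRecord x) 1 Φ` satisfies the three
binder facts of dag-n08-d's `ineq2153_one_lettersYOfRecordV4_of_scalarRow_star_st`: «B = 0 off the bonds with a good end block» (`inΛstY`), «B = 0 on the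
axial trees» (`IsAxialY`), «(Q(1)B)(c) = 0 at every star corner» (`CBondStY`) — so the (2.153) row at NODE 00's letters for `B` is that one-liner over
dag-n08-b's `scalarRow_star`, at EVERY member (no both-good restriction: CHECK-L repaired).
[cite: Balaban1985BackgroundPropagators, (3.156)–(3.157) p.428; Balaban1984PropagatorsII, (2.153)–(2.156) pp.249–250, (2.3) p.224, Lemma 2.4 p.245] -/
theorem elimCstY_one_mem_starSubspace (Φ : IBondY x.toKIdx → 𝔸) :
    (∀ q, ¬ inΛstY x q → elimCstY x (avYOfRecord x) (fun _ _ => 1 : CfgY 𝔸 x.toKIdx) Φ q = 0) ∧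
      (∀ q, IsAxialY x q → elimCstY x (avYOfRecord x) (fun _ _ => 1 : CfgY 𝔸 x.toKIdx) Φ q = 0) ∧
      (∀ c : CBondStY x, Q1Y x (avYOfRecord x) (fun _ _ => 1 : CfgY 𝔸 x.toKIdx) c.1 (elimCstY x (avYOfRecord x) (fun _ _ => 1) Φ) = 0) :=
  ⟨fun _ hq => elimCstY_apply_of_not_inΛstY x (avYOfRecord x) _ Φ hq, fun _ hq => elimCstY_apply_of_isAxialY x (avYOfRecord x) _ Φ hq,
    fun c => Q1Y_elimCstY_one x c Φ⟩

/-- ★ **and `C_st(1)Φ = Φ` on `Λ̃`** (so `‖Φ‖² ≤ ‖C_st(1)Φ‖²` for `Λ̃`-supported `Φ`: the transfer (2.153) ⇒ `γ₀`-row of `η^{d+1}C*Δ_kC(1)` goes through at the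
star letters exactly as at the source-convention letters). [cite: Balaban1985BackgroundPropagators, (3.157) p.428; Balaban1984PropagatorsII, (2.155) p.250] -/
theorem elimCstY_one_apply_of_lamTstY (Φ : IBondY x.toKIdx → 𝔸) {q : IBondY x.toKIdx} (hq : lamTstY x q) :
    elimCstY x (avYOfRecord x) (fun _ _ => 1 : CfgY 𝔸 x.toKIdx) Φ q = Φ q :=
  elimCstY_apply_of_lamTstY x (avYOfRecord x) _ Φ hq

/-- ★★ **THE SAME AT THE v7 STAR RECORD OF A STAGE 3′(Y) FAMILY** (`(sectEStYOfRecordV7 N θ M⋆ 𝔢₀ x).elimC 1 = C_st(1)`): the door's `B := C(1)Φ` at the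
star instance lies in print's star subspace, for every member `x` and every `Φ`. [cite: Balaban1985BackgroundPropagators, (3.156)–(3.157) p.428; Balaban1984PropagatorsII, (2.3) p.224, Lemma 2.4 p.245] -/
theorem sectEStYOfRecordV7_elimC_one_mem_starSubspace (N : ℕ) (θ : Stage3Params) (Mstar' : ℕ) (𝔢₀ : SectEY N θ Mstar')
    (x : MemberY θ.d₆ θ.ℓ₆ θ.hd' θ.hL' θ.b₀ θ.b₁ Mstar') (Φ : IBondY x.toKIdx → Matrix (Fin N) (Fin N) ℂ) :
    (∀ q, ¬ inΛstY x q → (sectEStYOfRecordV7 N θ Mstar' 𝔢₀ x).elimC (fun _ _ => 1) Φ q = 0) ∧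
      (∀ q, IsAxialY x q → (sectEStYOfRecordV7 N θ Mstar' 𝔢₀ x).elimC (fun _ _ => 1) Φ q = 0) ∧
      (∀ c : CBondStY x, Q1Y x (avYOfRecord x) (fun _ _ => 1 : CfgY (Matrix (Fin N) (Fin N) ℂ) x.toKIdx) c.1
        ((sectEStYOfRecordV7 N θ Mstar' 𝔢₀ x).elimC (fun _ _ => 1) Φ) = 0) :=
  elimCstY_one_mem_starSubspace x Φ

end DoorRequirement

end Literature.MathematicalPhysics.QuantumFieldTheory.Balaban1983to89.Node00

end
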